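import Summits.CriticalPhenomena.PercolationContinuityZ3.Theorems.Transplant.SiteKNElongated
import HarnessLib

/-!
# SITE Kozma–Nitzan §4 — Lemma 12: from the centre of a cell into the next cell through a corridor

builds on p205010 (kernel theorem, internal audit signed; external expert review pending).
Lane `prim-bschramm`, class C1a (site percolation on `ℤ³`); block (β) of the SITE same-`p` witness
(`SiteSameP.SiteSamePWitnessZd`, socket p217536), prim-hp-8 lineage.  Site twin of the Lemma-12 half of
`L/KozmaNitzanCorridor.lean`, threaded on `SiteTargetProperty d p` (site Lemma 10, prim-bschramm p1) and the site
Lemma 9 input `SiteLinkedOrthantFace d p`.  Helper file (`--supports stmt-CriticalPhenomena-4575`); no sorries.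

The GEOMETRY of Lemma 12 is imported VERBATIM from the bond file through the bond datum `S : CData d`
(direction, sign, centre, scale, finite support `Sfin`, source `o`; the subbox `bigD`, its far part `farE`, the near
cube `nearQ`, the subgraph `A = Sfin ∖ farE`, the corridor, `U = A ∪ corridor`, the last subbox `Dcorr`, the halved
cubes `B_k`, the target cube `Tn u` around the next centre, and the two target properties `isTarget_halving`,
`isTarget_corridor`).  The bond weighting slot `S.W` of `CData` is NOT read: the site datum is the pair of `S` and a
VERTEX weighting `w : Site d → [0,1]`, with hypotheses `SiteCHyp S w p` (`w` finitely supported on `Sfin`, equal to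
`p` on `bigD ⊆ Sfin`, `o ∈ Sfin ∖ bigD`).

* `siteHalvingStep_of_target`, `siteHalvingChain_of_target` — `d` applications of the site target property in the
  weighting restricted to `A` (`siteRestrW`), each halving one coordinate of the reached cube (KN p. 24);
* `siteCorridorStep_of_target` — the last application, in `U`, with the elongated geometries of aspect `88`
  (site Lemma 11, `siteIsHittable_elongGeom_of_target`);
* **`siteCorridorLemma_of_target`** — site Lemma 12:
  `P_w(o ↔ c + [-3r,3r]^d in A) > 1 − δ ⟹ P_w(o ↔ c + 20rσe_a + [-3r,3r]^d in U) > 1 − ε` for `r ≥ m(ε)`.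
[cite: KozmaNitzan2024, §4 Lemma 12 and its proof (pp. 23–25), Figure 1]
-/

noncomputable section

namespace Summit.CriticalPhenomena.PercolationContinuityZ3.Theorems.Transplant

namespace SiteKN

open MeasureTheory ProbabilityTheory
open Literature.Probability.Percolation Literature.Probability.LatticeModels
open Literature.Probability.Percolation.KozmaNitzan
open SiteTransplant (siteConn mem_siteConn)

variable {d : ℕ}

/-! ## The hypotheses of the site Lemma 12 -/

/-- **The hypotheses of the site Lemma 12** for the geometric datum `S : CData d` (whose bond weighting slot is not
read) and the vertex weighting `w`: `w` finitely supported on `Sfin ⊇ D`, `D` a site subbox at density `p`, and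
`o ∈ Sfin ∖ D`. [cite: KozmaNitzan2024, §4 Lemma 12 (p. 23)] -/
structure SiteCHyp (S : CData d) (w : Site d → unitInterval) (p : unitInterval) : Prop where
  /-- finite support -/
  fin : SiteFinSupp w S.Sfin
  /-- `D` is a site subbox at density `p` -/
  sub : SiteIsSubbox w p S.bigD
  /-- `D ⊆ Sfin` -/
  DS : S.bigD ⊆ S.Sfin
  /-- the source lies in the support -/
  o_mem : S.o ∈ S.Sfin
  /-- the source lies outside `D` -/
  o_not : S.o ∉ S.bigD

/-- The last subbox lies in `D`. [folklore] -/
theorem Dcorr_subset_bigD (S : CData d) : S.Dcorr ⊆ S.bigD := by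
  intro x hx
  rw [S.mem_Dcorr_iff] at hx
  rw [S.mem_bigD_iff]
  refine ⟨⟨by linarith [hx.1.1], by linarith [hx.1.2]⟩, fun j hj => ?_⟩
  have := hx.2 j hj
  constructor <;> linarith [this.1, this.2]

namespace SiteCHyp

variable {S : CData d} {w : Site d → unitInterval} {p : unitInterval} (h : SiteCHyp S w p)
include h

/-- The near cube lies in `A`. [folklore] -/
theorem nearQ_subset_Aset : S.nearQ ⊆ S.Aset := fun _ hx =>
  Finset.mem_sdiff.2 ⟨h.DS (S.nearQ_subset_bigD hx), S.nearQ_disjoint_farE hx⟩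

/-- `o ∈ A`. [folklore] -/
theorem o_mem_Aset : S.o ∈ S.Aset := by
  refine Finset.mem_sdiff.2 ⟨h.o_mem, fun ho => h.o_not ?_⟩
  rw [S.mem_farE_iff] at ho
  rw [S.mem_bigD_iff]
  exact ⟨⟨by linarith [ho.1.1], ho.1.2⟩, ho.2⟩

/-- `o` is not in the near cube. [folklore] -/
theorem o_not_mem_nearQ : S.o ∉ S.nearQ := fun ho => h.o_not (S.nearQ_subset_bigD ho)

/-- **The near cube is a site subbox of `w`.** [cite: KozmaNitzan2024, §4 p. 24] -/
theorem siteIsSubbox_nearQ : SiteIsSubbox w p S.nearQ := h.sub.anti S.nearQ_subset_bigD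

/-- **The last subbox is a site subbox of `w`.** [cite: KozmaNitzan2024, §4 p. 24] -/
theorem siteIsSubbox_Dcorr : SiteIsSubbox w p S.Dcorr := h.sub.anti (Dcorr_subset_bigD S)

/-- The last subbox lies in `U` (its near part in the near cube, the rest in the corridor). [cite: KozmaNitzan2024, §4 p. 24] -/
theorem Dcorr_subset_Uset : S.Dcorr ⊆ S.Uset := by
  intro x hx
  rw [S.mem_Dcorr_iff] at hx
  rw [CData.Uset, Finset.mem_union]
  by_cases hlev : S.σ * (x S.a - S.c S.a) ≤ 5 * S.r
  · left
    refine h.nearQ_subset_Aset ?_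
    rw [S.mem_nearQ_iff]
    intro i
    by_cases hi : i = S.a
    · subst hi
      rcases S.hσ with h1 | h1
      · rw [h1] at hx hlev; constructor <;> nlinarith [hx.1.1, hx.1.2]
      · rw [h1] at hx hlev; constructor <;> nlinarith [hx.1.1, hx.1.2]
    · have := hx.2 i hi; constructor <;> linarith [this.1, this.2]
  · right
    rw [S.mem_corridor_iff]
    push Not at hlev
    exact ⟨⟨hlev.le, hx.1.2⟩, hx.2⟩

/-- `o` is not in the last subbox. [folklore] -/
theorem o_not_mem_Dcorr : S.o ∉ S.Dcorr := fun ho => h.o_not (Dcorr_subset_bigD S ho)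

end SiteCHyp

/-! ## All elongated geometries of aspect `K` are site-hittable -/

/-- Every elongated geometry of aspect `K ≥ 2` is site-hittable (site Lemma 11). [cite: KozmaNitzan2024, §4 Lemma 11 (p. 22)] -/
theorem siteIsHittable_of_mem_elongList_of_target {p : unitInterval} (hT : SiteTargetProperty d p)
    (hL : SiteLinkedOrthantFace d p) (K : ℕ) (hK : 2 ≤ K) : ∀ g ∈ elongList d K (by omega), SiteIsHittable p g := by
  intro g hg
  obtain ⟨x, -, rfl⟩ := List.mem_map.1 hg
  exact siteIsHittable_elongGeom_of_target hT hL x.1 x.2 K hK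

/-! ## The halving steps (KN p. 24) -/

/-- **One halving step** (site target property in `A` with the quarter faces): whenever the cube `B_k` is reached from
`o` with probability `> 1 − δ` in the weighting restricted to `A`, then `B_{k+1}` is reached with probability `> 1 − ε`.
[cite: KozmaNitzan2024, §4 p. 24] -/
theorem siteHalvingStep_of_target {p : unitInterval} (hT : SiteTargetProperty d p) (hL : SiteLinkedOrthantFace d p)
    {ε : ℝ} (hε : 0 < ε) :
    ∃ δ : ℝ, 0 < δ ∧ ∃ R₀ : ℕ, ∀ (S : CData d) (w : Site d → unitInterval), SiteCHyp S w p →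
      ∀ (k R : ℕ), k < d → R₀ ≤ R → R₀ ≤ S.lh → ((S.r + 1) / 2 : ℕ) + (k : ℤ) * R + R ≤ S.r →
      1 - δ < (prodBernoulli (siteRestrW (↑S.Aset : Set (Site d)) w)).real
          (⋃ b ∈ S.Bk k R, siteConn (zdGraph d) S.o b) →
        1 - ε < (prodBernoulli (siteRestrW (↑S.Aset : Set (Site d)) w)).real
          (⋃ b ∈ S.Bk (k + 1) R, siteConn (zdGraph d) S.o b) := by
  obtain ⟨δ, hδ, hH⟩ := hT hε
  obtain ⟨R₀, hR₀⟩ := hH (qfList d) (siteIsHittable_of_mem_qfList_of_linked hL)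
  refine ⟨δ, hδ, R₀, fun S w hS k R hk hR hRlh hfit hB => ?_⟩
  have hR' : (R₀ : ℤ) ≤ R := by exact_mod_cast hR
  have hfit0 : ((S.r + 1) / 2 : ℕ) + (k : ℤ) * R + R₀ ≤ S.r := by linarith
  have hkR : (k : ℤ) * R + R₀ ≤ 2 * S.r := by
    have : (0 : ℤ) ≤ ((S.r + 1) / 2 : ℕ) := by positivity
    linarith
  have hkR1 : ((k + 1 : ℕ) : ℤ) * R ≤ 2 * S.r := by push_cast; linarith
  exact hR₀ (siteRestrW (↑S.Aset : Set (Site d)) w) S.Aset S.nearQ (S.c - S.hwid k R) (S.c + S.hwid k R)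
    (S.Bk (k + 1) R) S.o (siteFinSupp_siteRestrW S.Aset w)
    (hS.siteIsSubbox_nearQ.siteRestrW (Finset.coe_subset.2 hS.nearQ_subset_Aset))
    hS.nearQ_subset_Aset hS.o_mem_Aset hS.o_not_mem_nearQ (S.enlarge_Bk_subset_nearQ hkR)
    (S.isTarget_halving hk hR hRlh hfit0) (S.Bk_subset_nearQ hkR1) (S.Bk_nonempty _ _) hB

/-- **The chain of halving steps**: `n` steps from `B_k` to `B_{k+n}` (`k + n ≤ d`).
[cite: KozmaNitzan2024, §4 p. 24 ("We continue this way, each time halving one dimension")] -/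
theorem siteHalvingChain_of_target {p : unitInterval} (hT : SiteTargetProperty d p) (hL : SiteLinkedOrthantFace d p)
    (n : ℕ) {ε : ℝ} (hε : 0 < ε) :
    ∃ δ : ℝ, 0 < δ ∧ ∃ R₀ : ℕ, ∀ (S : CData d) (w : Site d → unitInterval), SiteCHyp S w p →
      ∀ (k R : ℕ), k + n ≤ d → R₀ ≤ R → R₀ ≤ S.lh → ((S.r + 1) / 2 : ℕ) + (d : ℤ) * R + R ≤ S.r →
      1 - δ < (prodBernoulli (siteRestrW (↑S.Aset : Set (Site d)) w)).real
          (⋃ b ∈ S.Bk k R, siteConn (zdGraph d) S.o b) →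
        1 - ε < (prodBernoulli (siteRestrW (↑S.Aset : Set (Site d)) w)).real
          (⋃ b ∈ S.Bk (k + n) R, siteConn (zdGraph d) S.o b) := by
  induction n generalizing ε with
  | zero =>
    refine ⟨ε, hε, 0, fun S w _ k R _ _ _ _ hB => ?_⟩
    simpa using hB
  | succ n ih =>
    obtain ⟨δ', hδ', R₁, h1⟩ := ih hε
    obtain ⟨δ, hδ, R₂, h2⟩ := siteHalvingStep_of_target hT hL hδ'
    refine ⟨δ, hδ, max R₁ R₂, fun S w hS k R hkn hR hRlh hfit hB => ?_⟩
    have hfitk : ((S.r + 1) / 2 : ℕ) + (k : ℤ) * R + R ≤ S.r := by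
      have : (k : ℤ) * R ≤ (d : ℤ) * R :=
        mul_le_mul_of_nonneg_right (by exact_mod_cast (by omega : k ≤ d)) (by positivity)
      linarith
    have step := h2 S w hS k R (by omega) (le_of_max_le_right hR) ((le_max_right _ _).trans hRlh) hfitk hB
    have rest := h1 S w hS (k + 1) R (by omega) (le_of_max_le_left hR) ((le_max_left _ _).trans hRlh) hfit step
    have e : k + 1 + n = k + (n + 1) := by ring
    rw [e] at rest
    exact rest

/-! ## The corridor step (KN pp. 24–25) -/

/-- **The corridor step** (the last application of the site target property, in the weighting restricted to `U`,
with the elongated geometries of aspect `88`): reaching the small cube `B_d` from `o` in `U` with probability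
`> 1 − δ` forces reaching `cnext + [-2r, 2r]^d` in `U` with probability `> 1 − ε`. [cite: KozmaNitzan2024, §4 pp. 24–25] -/
theorem siteCorridorStep_of_target {p : unitInterval} (hT : SiteTargetProperty d p) (hL : SiteLinkedOrthantFace d p)
    {ε : ℝ} (hε : 0 < ε) :
    ∃ δ : ℝ, 0 < δ ∧ ∃ R₀ : ℕ, ∀ (S : CData d) (w : Site d → unitInterval), SiteCHyp S w p →
      ∀ R : ℕ, 44 ≤ S.r → 5 * R₀ + 5 ≤ S.r → 4 * ((S.lh : ℤ) + d * R + R₀) + 4 ≤ 7 * S.r →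
      1 - δ < (prodBernoulli (siteRestrW (↑S.Uset : Set (Site d)) w)).real
          (⋃ b ∈ S.Bk d R, siteConn (zdGraph d) S.o b) →
        1 - ε < (prodBernoulli (siteRestrW (↑S.Uset : Set (Site d)) w)).real
          (⋃ b ∈ S.Tn (2 * S.r), siteConn (zdGraph d) S.o b) := by
  obtain ⟨δ, hδ, hH⟩ := hT hε
  obtain ⟨R₀, hR₀⟩ := hH (elongList d 88 (by norm_num))
    (siteIsHittable_of_mem_elongList_of_target hT hL 88 (by norm_num))
  refine ⟨δ, hδ, R₀, fun S w hS R h44 hRc hΔ hB => ?_⟩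
  -- `B_d⟨R₀⟩ ⊆ Dcorr` and `Tn (2r) ⊆ Dcorr`
  have hw : ∀ i, S.hwid d R i = S.lh + d * R := fun i => by rw [S.hwid_apply, if_pos i.2]
  have hRc' : 5 * (R₀ : ℤ) + 5 ≤ S.r := by exact_mod_cast hRc
  have hencl : Finset.Icc (S.c - S.hwid d R - (R₀ : Site d)) (S.c + S.hwid d R + (R₀ : Site d)) ⊆ S.Dcorr := by
    intro x hx
    rw [mem_Icc_iff] at hx
    simp only [Pi.sub_apply, Pi.add_apply, Pi.natCast_apply] at hx
    rw [S.mem_Dcorr_iff]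
    have hlh : (0 : ℤ) ≤ S.lh := by positivity
    refine ⟨?_, fun j hj => ?_⟩
    · have := hx S.a; rw [hw] at this
      have hb := level_bounds_of_abs_le S.hσ (x := S.c S.a) (y := x S.a) (ℓ := S.lh + d * R + R₀)
        (by linarith) (by linarith)
      have e : S.σ * (x S.a - S.c S.a) = S.σ * x S.a - S.σ * S.c S.a := by ring
      rw [e]; constructor <;> linarith [hb.1, hb.2]
    · have := hx j; rw [hw] at this
      constructor <;> linarith [this.1, this.2]
  have hTD : S.Tn (2 * S.r) ⊆ S.Dcorr := by
    intro x hx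
    rw [S.mem_Tn_iff] at hx
    rw [S.mem_Dcorr_iff]
    push_cast at hx
    refine ⟨⟨by linarith [hx.1.1], by linarith [hx.1.2]⟩, fun j hj => ?_⟩
    have := hx.2 j hj
    constructor <;> linarith [this.1, this.2]
  exact hR₀ (siteRestrW (↑S.Uset : Set (Site d)) w) S.Uset S.Dcorr (S.c - S.hwid d R) (S.c + S.hwid d R)
    (S.Tn (2 * S.r)) S.o (siteFinSupp_siteRestrW S.Uset w)
    (hS.siteIsSubbox_Dcorr.siteRestrW (Finset.coe_subset.2 hS.Dcorr_subset_Uset))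
    hS.Dcorr_subset_Uset (Finset.mem_union_left _ hS.o_mem_Aset) hS.o_not_mem_Dcorr hencl
    (S.isTarget_corridor h44 hRc hΔ) hTD (S.Tn_nonempty _) hB

/-! ## Site Lemma 12 -/

/-- **Site Lemma 12 from the site target property.**  For every `ε > 0` there are `δ > 0` and `m` such that for every
geometric datum `S` of scale `r ≥ m` and vertex weighting `w` satisfying `SiteCHyp S w p` (finitely supported, the
subbox `D = c + {-5r ≤ σ x_a ≤ 25r, |x_j| ≤ 5r}` at density `p`, `o ∉ D`):
`P_w(o ↔ c + [-3r,3r]^d in A) > 1 − δ ⟹ P_w(o ↔ cnext + [-3r,3r]^d in U) > 1 − ε`, where `A` = support minus the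
far part of `D`, `U = A ∪` corridor, `cnext = c + 20rσe_a`. [cite: KozmaNitzan2024, §4 Lemma 12 (pp. 23–25)] -/
theorem siteCorridorLemma_of_target {p : unitInterval} (hT : SiteTargetProperty d p) (hL : SiteLinkedOrthantFace d p)
    {ε : ℝ} (hε : 0 < ε) :
    ∃ δ : ℝ, 0 < δ ∧ ∃ m : ℕ, ∀ (S : CData d) (w : Site d → unitInterval), SiteCHyp S w p → m ≤ S.r →
      1 - δ < (prodBernoulli w).real
          (⋃ b ∈ Finset.Icc (S.c - ((3 * S.r : ℕ) : Site d)) (S.c + ((3 * S.r : ℕ) : Site d)),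
            siteConnIn (zdGraph d) (↑S.Aset : Set (Site d)) S.o b) →
        1 - ε < (prodBernoulli w).real
          (⋃ b ∈ S.Tn (3 * S.r), siteConnIn (zdGraph d) (↑S.Uset : Set (Site d)) S.o b) := by
  classical
  obtain ⟨δc, hδc, Rc, hcorr⟩ := siteCorridorStep_of_target hT hL hε
  obtain ⟨δh, hδh, Rh, hhalf⟩ := siteHalvingChain_of_target hT hL d hδc
  set R : ℕ := max Rc Rh with hRdef
  refine ⟨δh, hδh, 100 * (d + 1) * (R + 1), fun S w hS hm hA => ?_⟩
  -- arithmetic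
  have hR1 : Rc ≤ R := le_max_left _ _
  have hR2 : Rh ≤ R := le_max_right _ _
  have hm' : 100 * ((d : ℤ) + 1) * (R + 1) ≤ S.r := by exact_mod_cast hm
  have hd0 : (0 : ℤ) ≤ d := by positivity
  have hR0 : (0 : ℤ) ≤ R := by positivity
  have hdR : (0 : ℤ) ≤ d * R := by positivity
  have hexp : 100 * ((d : ℤ) + 1) * (R + 1) = 100 * (d * R) + 100 * d + 100 * R + 100 := by ring
  have hlh := S.two_lh
  have hhalf' : (((S.r + 1) / 2 : ℕ) : ℤ) + (S.r : ℤ) = S.lh := by unfold CData.lh; push_cast; ring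
  have hRc' : (Rc : ℤ) ≤ R := by exact_mod_cast hR1
  have hRh' : (Rh : ℤ) ≤ R := by exact_mod_cast hR2
  -- into the restricted weighting on `A`
  have h0 : 1 - δh < (prodBernoulli (siteRestrW (↑S.Aset : Set (Site d)) w)).real
      (⋃ b ∈ S.Bk 0 R, siteConn (zdGraph d) S.o b) := by
    rw [S.Bk_zero, ← Finset.set_biUnion_coe, prodBernoulli_siteRestrW_real_biUnion_siteConn (zdGraph d) w _ S.o,
      Finset.set_biUnion_coe]
    exact hA
  -- the halving chain
  have h1 := hhalf S w hS 0 R (by omega) hR2 ?_ ?_ h0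
  rotate_left
  · have : (R : ℤ) ≤ S.lh := by linarith
    have : (Rh : ℤ) ≤ S.lh := by linarith
    exact_mod_cast this
  · have hdRh : (d : ℤ) * R ≤ d * R := le_rfl
    linarith
  rw [zero_add] at h1
  -- from `A` to `U`
  have h2 : 1 - δc < (prodBernoulli (siteRestrW (↑S.Uset : Set (Site d)) w)).real
      (⋃ b ∈ S.Bk d R, siteConn (zdGraph d) S.o b) := by
    rw [← Finset.set_biUnion_coe, prodBernoulli_siteRestrW_real_biUnion_siteConn (zdGraph d) w _ S.o]
    rw [← Finset.set_biUnion_coe, prodBernoulli_siteRestrW_real_biUnion_siteConn (zdGraph d) w _ S.o] at h1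
    exact h1.trans_le (measureReal_mono
      (biUnion_siteConnIn_mono (zdGraph d) (Finset.coe_subset.2 S.Aset_subset_Uset) S.o subset_rfl)
      (measure_ne_top _ _))
  -- the corridor step
  have h3 := hcorr S w hS R ?_ ?_ ?_ h2
  rotate_left
  · have : (44 : ℤ) ≤ S.r := by linarith
    exact_mod_cast this
  · have : 5 * (Rc : ℤ) + 5 ≤ S.r := by linarith
    exact_mod_cast this
  · have : (d : ℤ) * Rc ≤ d * R := mul_le_mul_of_nonneg_left hRc' hd0
    nlinarith
  -- back to `w`, and the larger target cube
  rw [← Finset.set_biUnion_coe, prodBernoulli_siteRestrW_real_biUnion_siteConn (zdGraph d) w _ S.o] at h3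
  rw [← Finset.set_biUnion_coe]
  refine h3.trans_le (measureReal_mono
    (biUnion_siteConnIn_mono (zdGraph d) subset_rfl S.o (Finset.coe_subset.2 ?_)) (measure_ne_top _ _))
  intro x hx
  rw [S.mem_Tn_iff] at hx ⊢
  push_cast at hx ⊢
  refine ⟨⟨by linarith [hx.1.1], by linarith [hx.1.2]⟩, fun j hj => ?_⟩
  have := hx.2 j hj
  constructor <;> linarith [this.1, this.2]

end SiteKN

end Summit.CriticalPhenomena.PercolationContinuityZ3.Theorems.Transplant

end
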